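/-
HODGE LADDER — STAGE 4, §0-bis: the powers clause of Arapura 2006 Lemma 4.2 and the DISCHARGE of the Literature
record `HodgeTheory.Arapura2006_hodgeClasses_algebraic_of_isDominatedByPowers` (both conjuncts).  Literature seat
hodge-director-lit-stage4, gen 7; companion document run/shared/lean/pub/hodge-director/STAGE4-ABELIAN-MOTIVIC-TYPE.md
(v7).  Theorems only.  Sibling of `CorCM/Stage4StrictRoadDischarge.lean` (the variety itself).
-/
import Summits.HodgeConjecture.CorCM.Stage4StrictRoadDischarge
import Literature.AlgebraicGeometry.HodgeTheory.KunnethCrossProductsSpanProofs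
import Literature.AlgebraicGeometry.HodgeTheory.GysinBaseChangeOfKunneth
import Literature.AlgebraicGeometry.HodgeTheory.MotivatedClassesAlgebraic
import Literature.AlgebraicGeometry.HodgeTheory.LefschetzStandardUnconditionalDegrees
import Literature.AlgebraicGeometry.HodgeTheory.CorrespondenceCupProductIdentities
import Literature.AlgebraicGeometry.Motives.VarietiesUnitProofs
import Literature.AlgebraicTopology.SingularHomology.CupProductProofs
import HarnessLib

/-!
# Stage 4, §0-bis: domination by powers is inherited by products and powers; Arapura 2006 Lemma 4.2 (HC clause, algebraic form) — the Literature record DISCHARGED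

D. Arapura, *Motivation for Hodge cycles*, Adv. Math. 207 (2006), Lemma 4.2: "… then the same conjecture holds
for `Y` and all its powers" — the powers because `M_A(X)` is a TENSOR category: if `[Y] ∈ M_A(X)` then
`[Yᵐ] = [Y]^{⊗m} ∈ M_A(X)`.  On the tree's real carriers (`HodgeTheory.IsDominatedByPowers`: `Hᵏ(Y(ℂ); ℂ)` is
spanned by the images of algebraic correspondences from the cartesian powers `Xᵉ`) this is the statement that
domination is stable under products, proved here from four theorems of the tree: the Künneth spanning of
`H*((C ⊗ A)(ℂ))` by cross products (Hatcher Thm. 3.15, `Hatcher2002_crossProducts_span_complexBetti_holds`), the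
closure of algebraic correspondences under pull-backs, cup products with algebraic classes, Gysin morphisms and
composition (`isAlgebraicCorrespondence_map`, `…_flip_cupProduct_of_mem_algebraicClasses`, `…_complexGysin`,
ring 2's `IsAlgebraicCorrespondence.comp`), the projection formula (`complexGysin_cup`) and the Gysin base change
for a product square (`gysin_baseChange_of_kunneth`).  The key step is the EXTERNAL PRODUCT of an algebraic
correspondence with an identity factor (Fulton, *Intersection Theory*, Ex. 16.1.1 / Prop. 16.1.1):
`exists_isAlgebraicCorrespondence_whiskerLeft` — for `T : Hᵃ(A) → Hᵇ(B)` algebraic and any smooth projective `C`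
there is an algebraic `W : H(C ⊗ A) → H(C ⊗ B)` with `W(pr_C^* z ∪ pr_A^* x) = pr_C^* z ∪ pr_B^* T(x)`, namely
`W = c • (C ◁ pr_B)_* ∘ (– ∪ pr_{B⊗A}^* γ) ∘ (C ◁ pr_A)^*` on `C ⊗ (B ⊗ A)` for `T = γ_*`; the action on the
left factor is obtained by conjugating with the braidings, whose pull-backs are algebraic correspondences.

Content (theorems only; no definition, no named fact): `exists_isAlgebraicCorrespondence_whiskerLeft`;
`IsDominatedByPowers.tensor` (products of dominated varieties are dominated), `isDominatedByPowers_unit`,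
`nonempty_powTensorPowIso` (`Xᶠ ⊗ Xᵉ ≅ X^{f+e}`), `IsDominatedByPowers.pow_succ`;
**`Arapura2006_hodgeClasses_algebraic_of_isDominatedByPowers_holds`** — the record, PROVED (first conjunct:
`hodgeConjectureFor_of_isDominatedByPowers` of the sibling file; second: the same for `Y^{m+1}`, dominated by the
powers of `X`).  Hence `hc_of_isDominatedByPowers_abelianVariety`, `hc_K3HilbertScheme_of_hc_K3Powers`, … of
`CorCM/Stage4StrictAbelianType` lose their hypothesis `h42` (fed `…_holds`): the STRICT road of the scoping
document runs on `HC_AV` (resp. row 1) and the geometric domination records (de Cataldo–Migliorini, Xu) alone.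

References: Arapura2006 (§1 Lemma 1.1, §4 Lemma 4.2); Fulton1998 (§16.1 Ex. 16.1.1, Prop. 16.1.1);
FultonYoungTableaux1997 (App. B §B.1 (1)–(6)); HatcherAT2002 (§3.2 Thm. 3.15, Prop. 3.10); VoisinHodgeII2003
(§9.2.4 Prop. 9.20–9.21, proof of Thm. 10.17 (10.7)); Andre1996Motifs (§2.1 p. 14–15, §4 (tensor structure)).
-/

noncomputable section

namespace Summit.HodgeConjecture.CorCM.Stage4

open CategoryTheory MonoidalCategory CartesianMonoidalCategory
open Literature.AlgebraicGeometry Literature.AlgebraicGeometry.Motives Literature.AlgebraicGeometry.HodgeTheory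
open Literature.AlgebraicTopology.SingularHomology
open Summit.HodgeConjecture.HodgeConjecture.Theorems (fulton1998_map_mem_algebraicClasses_holds)
open Summit.HodgeConjecture.HodgeConjecture.Ring2.AbelianAll (IsAlgebraicCorrespondence.exists_eq_corrAction
  IsAlgebraicCorrespondence.comp IsAlgebraicCorrespondence.smul IsAlgebraicCorrespondence.le_two_mul)

/-! ## §1 The external product of an algebraic correspondence with an identity factor -/

section Whisker

variable {l m n : ℕ} {C B A : SchemeOver ℂ}

/-- **External product with an identity factor** (Fulton Ex. 16.1.1 / Prop. 16.1.1 on the real carriers): for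
`C, B, A` smooth projective, `T : Hᵃ(A(ℂ)) → Hᵇ(B(ℂ))` induced by an algebraic correspondence and degrees
`j + a = k`, `j + b = k' ≤ 2 dim (C ⊗ B)`, there is a linear map `W : Hᵏ((C ⊗ A)(ℂ)) → H^{k'}((C ⊗ B)(ℂ))`
induced by an algebraic correspondence with `W (pr_C^* z ∪ pr_A^* x) = pr_C^* z ∪ pr_B^* (T x)` for all
`z ∈ Hʲ(C(ℂ))`, `x ∈ Hᵃ(A(ℂ))`.  Proof: `T = γ_*` for the complex orientations (`exists_eq_corrAction`); on
`C ⊗ (B ⊗ A)` put `W₀ = (C ◁ pr_B)_* ∘ (– ∪ pr_{B⊗A}^* γ) ∘ (C ◁ pr_A)^*`, a composite of three algebraic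
correspondences; `(C ◁ pr_A)^*(pr_C^* z ∪ pr_A^* x) ∪ pr_{B⊗A}^* γ = pr_C^* z ∪ pr_{B⊗A}^*(pr_A^* x ∪ γ)`
(functoriality, multiplicativity and associativity), the projection formula gives
`W₀(…) = pr_C^* z ∪ (C ◁ pr_B)_* pr_{B⊗A}^* v`, and the product base change
`pr_{B}^*∘(pr_B)_* = c • (C ◁ pr_B)_* ∘ pr_{B⊗A}^*` (read on `C ⊗ B`) identifies `c • W₀` with the required map.
[cite: Fulton1998, §16.1 Ex. 16.1.1 and Prop. 16.1.1] [cite: FultonYoungTableaux1997, Appendix B §B.1 (1), (5), (6)]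
[cite: VoisinHodgeII2003, proof of Thm. 10.17 (10.7)] -/
theorem exists_isAlgebraicCorrespondence_whiskerLeft (hC : IsSmoothProjective l C)
    (hB : IsSmoothProjective m B) (hA : IsSmoothProjective n A) {a b : ℕ}
    {T : complexBetti A a →ₗ[ℂ] complexBetti B b} (hT : IsAlgebraicCorrespondence m n B A T)
    {j k k' : ℕ} (hk : j + a = k) (hk' : j + b = k') (hdeg : k' ≤ 2 * (l + m)) :
    ∃ W : complexBetti (C ⊗ A) k →ₗ[ℂ] complexBetti (C ⊗ B) k',
      IsAlgebraicCorrespondence (l + m) (l + n) (C ⊗ B) (C ⊗ A) W ∧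
        ∀ (z : complexBetti C j) (x : complexBetti A a),
          W (cupProduct hk (complexBetti.map (fst C A) j z) (complexBetti.map (snd C A) a x)) =
            cupProduct hk' (complexBetti.map (fst C B) j z) (complexBetti.map (snd C B) b (T x)) := by
  obtain ⟨e, hab, γ, hγ, rfl⟩ := IsAlgebraicCorrespondence.exists_eq_corrAction hB hA hT
  have hBA := IsSmoothProjective.tensor_holds hB hA
  have hP := IsSmoothProjective.tensor_holds hC hBA
  have hCA := IsSmoothProjective.tensor_holds hC hA
  have hCB := IsSmoothProjective.tensor_holds hC hB
  -- the algebraic class `pr_{B⊗A}^* γ` on `C ⊗ (B ⊗ A)` and the three maps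
  set γP : complexBetti (C ⊗ (B ⊗ A)) (2 * e) := complexBetti.map (snd C (B ⊗ A)) (2 * e) γ with hγP
  have hγPa : γP ∈ algebraicClasses (C ⊗ (B ⊗ A)) e :=
    fulton1998_map_mem_algebraicClasses_holds (snd C (B ⊗ A)) hBA hP e γ hγ
  have hke : k + 2 * e + 2 * (l + m) = k' + 2 * (l + (m + n)) := by omega
  set Pb : complexBetti (C ⊗ A) k →ₗ[ℂ] complexBetti (C ⊗ (B ⊗ A)) k :=
    (complexBetti.map (C ◁ snd B A) k).hom with hPb
  set Cu : complexBetti (C ⊗ (B ⊗ A)) k →ₗ[ℂ] complexBetti (C ⊗ (B ⊗ A)) (k + 2 * e) :=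
    (cupProduct (rfl : k + 2 * e = k + 2 * e)).flip γP with hCu
  set Gy : complexBetti (C ⊗ (B ⊗ A)) (k + 2 * e) →ₗ[ℂ] complexBetti (C ⊗ B) k' :=
    complexGysin complexOrientationFamily hP hCB (C ◁ fst B A) hke with hGy
  -- the product base change, read on `C ⊗ B`
  obtain ⟨c, hc⟩ := gysin_baseChange_of_kunneth complexOrientationFamily hC hB hA
    Hatcher2002_crossProducts_span_complexBetti_holds (k := a + 2 * e) (k₁ := b)
    (show a + 2 * e + 2 * m = b + 2 * (m + n) by omega)
  refine ⟨c • (Gy ∘ₗ Cu ∘ₗ Pb), ?_, fun z x ↦ ?_⟩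
  · -- a composite of algebraic correspondences
    refine IsAlgebraicCorrespondence.smul hCB hCA ?_ c
    have h1 : IsAlgebraicCorrespondence (l + (m + n)) (l + n) (C ⊗ (B ⊗ A)) (C ⊗ A) Pb :=
      isAlgebraicCorrespondence_map hP hCA (C ◁ snd B A) (by omega)
    have h2 : IsAlgebraicCorrespondence (l + (m + n)) (l + (m + n)) (C ⊗ (B ⊗ A)) (C ⊗ (B ⊗ A)) Cu :=
      isAlgebraicCorrespondence_flip_cupProduct_of_mem_algebraicClasses hP rfl (by omega) hγPa
    have h3 : IsAlgebraicCorrespondence (l + m) (l + (m + n)) (C ⊗ B) (C ⊗ (B ⊗ A)) Gy :=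
      isAlgebraicCorrespondence_complexGysin complexOrientationFamily
        (OrientationFamily.hasPoincareDuality _) hP hCB (C ◁ fst B A) hke
        (show k' + (2 * (l + m) - k') = 2 * (l + m) by omega)
    exact IsAlgebraicCorrespondence.comp hCB hP hCA (IsAlgebraicCorrespondence.comp hP hP hCA h1 h2 (by omega))
      h3 (by omega)
  · -- the value on a cross product
    have hjs : j + (a + 2 * e) = k + 2 * e := by omega
    have hq : a + 2 * e + 2 * (l + m) = b + 2 * (l + (m + n)) := by omega
    rw [LinearMap.smul_apply, LinearMap.comp_apply, LinearMap.comp_apply]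
    -- (1) pull-back along `C ◁ pr_A`: `pr_C^* z ∪ pr_{B⊗A}^* pr_A^* x`
    have h1 : Pb (cupProduct hk (complexBetti.map (fst C A) j z) (complexBetti.map (snd C A) a x)) =
        cupProduct hk (complexBetti.map (fst C (B ⊗ A)) j z)
          (complexBetti.map (snd C (B ⊗ A)) a (complexBetti.map (snd B A) a x)) := by
      rw [hPb]
      change complexBetti.map (C ◁ snd B A) k _ = _
      rw [complexBetti.map_cupProduct, ← complexBetti.map_comp_apply', ← complexBetti.map_comp_apply',
        whiskerLeft_fst, whiskerLeft_snd, complexBetti.map_comp_apply']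
    -- (2) cup product with `pr_{B⊗A}^* γ`: `pr_C^* z ∪ pr_{B⊗A}^* (pr_A^* x ∪ γ)`
    have h2 : Cu (cupProduct hk (complexBetti.map (fst C (B ⊗ A)) j z)
          (complexBetti.map (snd C (B ⊗ A)) a (complexBetti.map (snd B A) a x))) =
        cupProduct hjs (complexBetti.map (fst C (B ⊗ A)) j z)
          (complexBetti.map (snd C (B ⊗ A)) (a + 2 * e)
            (cupProduct (rfl : a + 2 * e = a + 2 * e) (complexBetti.map (snd B A) a x) γ)) := by
      rw [hCu, LinearMap.flip_apply, hγP, cupProduct_assoc hk rfl rfl hjs, complexBetti.map_cupProduct]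
    -- (3) projection formula for `C ◁ pr_B`
    have h3 : Gy (cupProduct hjs (complexBetti.map (fst C (B ⊗ A)) j z)
          (complexBetti.map (snd C (B ⊗ A)) (a + 2 * e)
            (cupProduct (rfl : a + 2 * e = a + 2 * e) (complexBetti.map (snd B A) a x) γ))) =
        cupProduct hk' (complexBetti.map (fst C B) j z)
          (complexGysin complexOrientationFamily hP hCB (C ◁ fst B A) hq
            (complexBetti.map (snd C (B ⊗ A)) (a + 2 * e)
              (cupProduct (rfl : a + 2 * e = a + 2 * e) (complexBetti.map (snd B A) a x) γ))) := by
      rw [hGy, ← whiskerLeft_fst C (fst B A), complexBetti.map_comp_apply']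
      exact complexGysin_cup (OrientationFamily.hasPoincareDuality _) hP hCB (C ◁ fst B A) hjs hke hq
        hk' _ _
    rw [h1, h2, h3, corrAction_apply, hc, map_smul]

end Whisker

/-! ## §2 Domination by the powers of `X` is stable under products; powers of a dominated variety; the record -/

section Products

variable {dX l n : ℕ} {X C A : SchemeOver ℂ}

/-- The source degree of an algebraic correspondence `Hᵃ(X) → Hᵇ(W)` satisfies `a ≤ b + 2 dim X`
(`a + 2e = b + 2 dim X` for the codimension `e` of the class). [cite: Andre1996Motifs, §2.1 (p. 14)] -/
theorem isAlgebraicCorrespondence_source_le {m' n' : ℕ} {W X' : SchemeOver ℂ} {a b : ℕ}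
    {T : complexBetti X' a →ₗ[ℂ] complexBetti W b} (h : IsAlgebraicCorrespondence m' n' W X' T) :
    a ≤ b + 2 * n' := by
  obtain ⟨_, _, _, _, _, _, hab, _, _⟩ := h
  omega

/-- **Pull-back along the braiding on a cross product**: `(β_{U,V})^*(pr_V^* y ∪ pr_U^* x) = (−1)^{qp} · (pr_U^* x ∪ pr_V^* y)`
(`β ≫ pr_V = pr_V`, `β ≫ pr_U = pr_U` on `U ⊗ V → V ⊗ U`; graded commutativity, Hatcher Thm. 3.11).
[cite: HatcherAT2002, §3.2 Prop. 3.10 and Thm. 3.11] -/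
theorem map_braiding_hom_cross {U V : SchemeOver ℂ} {p q s : ℕ} (h : q + p = s) (h' : p + q = s)
    (x : complexBetti U p) (y : complexBetti V q) :
    complexBetti.map (β_ U V).hom s
        (cupProduct h (complexBetti.map (fst V U) q y) (complexBetti.map (snd V U) p x)) =
      ((-1 : ℂ) ^ (q * p)) •
        cupProduct h' (complexBetti.map (fst U V) p x) (complexBetti.map (snd U V) q y) := by
  rw [complexBetti.map_cupProduct, ← complexBetti.map_comp_apply', ← complexBetti.map_comp_apply',
    braiding_hom_fst, braiding_hom_snd]
  exact cupProduct_gradedComm_holds ℂ (Motives.ComplexPoints (U ⊗ V)) h h' _ _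

/-- `Xᶠ ⊗ Xᵉ ≅ X^{f+e}` (re-bracketing the iterated product `X^{m+1} = Xᵐ ⊗ X`: right unitor and associators).
[folklore] -/
theorem nonempty_powTensorPowIso (X : SchemeOver ℂ) (f : ℕ) :
    ∀ e : ℕ, Nonempty (X.pow f ⊗ X.pow e ≅ X.pow (f + e))
  | 0 => ⟨ρ_ (X.pow f)⟩
  | e + 1 => (nonempty_powTensorPowIso X f e).elim fun i ↦
      ⟨(α_ (X.pow f) (X.pow e) X).symm ≪≫ whiskerRightIso i X⟩

/-- **The point `Spec ℂ` is dominated by the powers of any `X`**: `H⁰` is reached by the identity correspondence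
from `X⁰ = Spec ℂ` (the graph of `𝟙`, `isAlgebraicCorrespondence_map`), and `Hᵏ = 0` for `k > 0`.
[cite: Arapura2006, §1 Lemma 1.1] -/
theorem isDominatedByPowers_unit (hX : IsSmoothProjective dX X) :
    IsDominatedByPowers 0 (𝟙_ (SchemeOver ℂ)) dX X := by
  intro k
  refine eq_top_iff.2 fun c _ ↦ ?_
  rcases Nat.eq_zero_or_pos k with rfl | hk
  · have h0 : IsSmoothProjective (0 * dX) (X.pow 0) := hX.pow 0
    have hT : IsAlgebraicCorrespondence 0 (0 * dX) (𝟙_ (SchemeOver ℂ)) (X.pow 0)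
        (complexBetti.map (𝟙 (X.pow 0)) 0).hom :=
      isAlgebraicCorrespondence_map (isSmoothProjective_unit_holds ℂ) h0 (𝟙 (X.pow 0)) le_rfl
    refine Submodule.subset_span ⟨0, 0, (complexBetti.map (𝟙 (X.pow 0)) 0).hom, hT, c, ?_⟩
    change complexBetti.map (𝟙 (X.pow 0)) 0 c = c
    rw [complexBetti.map_id]
    rfl
  · haveI := subsingleton_complexBetti (isSmoothProjective_unit_holds ℂ) (k := k) (by omega)
    rw [Subsingleton.elim c 0]
    exact Submodule.zero_mem _

/-- **Products of dominated varieties are dominated** (Arapura 2006 §1/§4: `M_A(X)` is a tensor category; on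
the real carriers): if `C` (dimension `l`) and `A` (dimension `n`) are dominated by the powers of `X`, so is
`C ⊗ A`.  Proof: `Hᵏ((C ⊗ A)(ℂ))` is spanned by cross products `pr_C^* z ∪ pr_A^* x` (Künneth,
`Hatcher2002_crossProducts_span_complexBetti_holds`), bilinear in `(z, x)`, so it suffices to treat `z = T z₀`,
`x = S x₀` for algebraic correspondences `T`, `S` from `X^{e₁}`, `X^{e₂}`; then
`pr_C^* (T z₀) ∪ pr_A^* (S x₀) = ± (W₁ ∘ β^* ∘ W₂ ∘ φ^*)(y)` for the external products `W₁ = C ⊗ S`,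
`W₂ = X^{e₂} ⊗ T` of §1, the braiding `β : C ⊗ X^{e₂} ≅ X^{e₂} ⊗ C`, the re-bracketing
`φ : X^{e₂} ⊗ X^{e₁} ≅ X^{e₂+e₁}` and `y = (φ⁻¹)^*(pr^* x₀ ∪ pr^* z₀)` — a composite of algebraic correspondences
(`IsAlgebraicCorrespondence.comp`, `isAlgebraicCorrespondence_map`). [cite: Arapura2006, §1 Lemma 1.1 and §4 Lemma 4.2]
[cite: Fulton1998, §16.1 Prop. 16.1.1] [cite: HatcherAT2002, §3.2 Thm. 3.15] -/
theorem isDominatedByPowers_tensor (hX : IsSmoothProjective dX X) (hC : IsSmoothProjective l C)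
    (hA : IsSmoothProjective n A) (hdC : IsDominatedByPowers l C dX X) (hdA : IsDominatedByPowers n A dX X) :
    IsDominatedByPowers (l + n) (C ⊗ A) dX X := by
  classical
  intro k
  have hCA := IsSmoothProjective.tensor_holds hC hA
  refine eq_top_iff.2 fun w _ ↦ ?_
  refine Submodule.span_le.2 ?_ (Hatcher2002_crossProducts_span_complexBetti_holds hC hA k w)
  rintro _ ⟨i, j, hij, z, x, rfl⟩
  rw [SetLike.mem_coe]
  -- the cross product is bilinear: reduce to generators of the two dominations
  set Φ : complexBetti C i →ₗ[ℂ] complexBetti A j →ₗ[ℂ] complexBetti (C ⊗ A) k :=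
    (cupProduct hij).compl₁₂ (complexBetti.map (fst C A) i).hom (complexBetti.map (snd C A) j).hom with hΦ
  have hz : z ∈ Submodule.span ℂ {c : complexBetti C i | ∃ (e a : ℕ)
      (T : complexBetti (X.pow e) a →ₗ[ℂ] complexBetti C i),
      IsAlgebraicCorrespondence l (e * dX) C (X.pow e) T ∧ c ∈ LinearMap.range T} := by
    rw [hdC i]; exact Submodule.mem_top
  have hx : x ∈ Submodule.span ℂ {c : complexBetti A j | ∃ (e a : ℕ)
      (T : complexBetti (X.pow e) a →ₗ[ℂ] complexBetti A j),
      IsAlgebraicCorrespondence n (e * dX) A (X.pow e) T ∧ c ∈ LinearMap.range T} := by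
    rw [hdA j]; exact Submodule.mem_top
  have hzx := Submodule.apply_mem_map₂ Φ hz hx
  rw [Submodule.map₂_span_span] at hzx
  change Φ z x ∈ _
  refine Submodule.span_le.2 ?_ hzx
  rintro _ ⟨_, ⟨e₁, a₁, T, hT, z₀, rfl⟩, _, ⟨e₂, a₂, S, hS, x₀, rfl⟩, rfl⟩
  rw [SetLike.mem_coe]
  change cupProduct hij (complexBetti.map (fst C A) i (T z₀)) (complexBetti.map (snd C A) j (S x₀)) ∈ _
  -- degrees
  have hi : i ≤ 2 * l := IsAlgebraicCorrespondence.le_two_mul hT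
  have hj : j ≤ 2 * n := IsAlgebraicCorrespondence.le_two_mul hS
  have ha₁i : a₁ ≤ i + 2 * (e₁ * dX) := isAlgebraicCorrespondence_source_le hT
  have ha₂j : a₂ ≤ j + 2 * (e₂ * dX) := isAlgebraicCorrespondence_source_le hS
  have hde : (e₂ + e₁) * dX = e₂ * dX + e₁ * dX := Nat.add_mul e₂ e₁ dX
  by_cases ha₁ : a₁ ≤ 2 * (e₁ * dX); swap
  · haveI := subsingleton_complexBetti (hX.pow e₁) (not_le.1 ha₁)
    rw [Subsingleton.elim z₀ 0, map_zero, map_zero, map_zero, LinearMap.zero_apply]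
    exact Submodule.zero_mem _
  by_cases ha₂ : a₂ ≤ 2 * (e₂ * dX); swap
  · haveI := subsingleton_complexBetti (hX.pow e₂) (not_le.1 ha₂)
    rw [Subsingleton.elim x₀ 0, map_zero, map_zero, map_zero]
    exact Submodule.zero_mem _
  -- the external products `W₁ = C ⊗ S : H(C ⊗ X^{e₂}) → H(C ⊗ A)`, `W₂ = X^{e₂} ⊗ T : H(X^{e₂} ⊗ X^{e₁}) → H(X^{e₂} ⊗ C)`
  obtain ⟨W₁, hW₁, hW₁v⟩ := exists_isAlgebraicCorrespondence_whiskerLeft hC hA (hX.pow e₂) hS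
    (j := i) (k := a₂ + i) (k' := k) (by omega) hij (by omega)
  obtain ⟨W₂, hW₂, hW₂v⟩ := exists_isAlgebraicCorrespondence_whiskerLeft (hX.pow e₂) hC (hX.pow e₁) hT
    (j := a₂) (k := a₂ + a₁) (k' := a₂ + i) rfl rfl (by omega)
  obtain ⟨φ⟩ := nonempty_powTensorPowIso X e₂ e₁
  have hXX := IsSmoothProjective.tensor_holds (hX.pow e₂) (hX.pow e₁)
  have hXC := IsSmoothProjective.tensor_holds (hX.pow e₂) hC
  have hCX := IsSmoothProjective.tensor_holds hC (hX.pow e₂)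
  have hσ : IsAlgebraicCorrespondence (l + e₂ * dX) (e₂ * dX + l) (C ⊗ X.pow e₂) (X.pow e₂ ⊗ C)
      (complexBetti.map (β_ C (X.pow e₂)).hom (a₂ + i)).hom :=
    isAlgebraicCorrespondence_map hCX hXC (β_ C (X.pow e₂)).hom (by omega)
  have hφ : IsAlgebraicCorrespondence (e₂ * dX + e₁ * dX) ((e₂ + e₁) * dX) (X.pow e₂ ⊗ X.pow e₁)
      (X.pow (e₂ + e₁)) (complexBetti.map φ.hom (a₂ + a₁)).hom :=
    isAlgebraicCorrespondence_map hXX (hX.pow (e₂ + e₁)) φ.hom (by omega)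
  set R : complexBetti (X.pow (e₂ + e₁)) (a₂ + a₁) →ₗ[ℂ] complexBetti (C ⊗ A) k :=
    W₁ ∘ₗ (complexBetti.map (β_ C (X.pow e₂)).hom (a₂ + i)).hom ∘ₗ W₂ ∘ₗ
      (complexBetti.map φ.hom (a₂ + a₁)).hom with hR
  have hRalg : IsAlgebraicCorrespondence (l + n) ((e₂ + e₁) * dX) (C ⊗ A) (X.pow (e₂ + e₁)) R := by
    refine IsAlgebraicCorrespondence.comp hCA hCX (hX.pow _) ?_ hW₁ (by omega)
    refine IsAlgebraicCorrespondence.comp hCX hXC (hX.pow _) ?_ hσ (by omega)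
    exact IsAlgebraicCorrespondence.comp hXC hXX (hX.pow _) hφ hW₂ (by omega)
  -- the value: `R ((φ⁻¹)^* (pr^* x₀ ∪ pr^* z₀)) = (−1)^{a₂ i} · (pr_C^* T z₀ ∪ pr_A^* S x₀)`
  set y₀ : complexBetti (X.pow e₂ ⊗ X.pow e₁) (a₂ + a₁) :=
    cupProduct (rfl : a₂ + a₁ = a₂ + a₁) (complexBetti.map (fst (X.pow e₂) (X.pow e₁)) a₂ x₀)
      (complexBetti.map (snd (X.pow e₂) (X.pow e₁)) a₁ z₀) with hy₀
  have hRy : R (complexBetti.map φ.inv (a₂ + a₁) y₀) =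
      ((-1 : ℂ) ^ (a₂ * i)) •
        cupProduct hij (complexBetti.map (fst C A) i (T z₀)) (complexBetti.map (snd C A) j (S x₀)) := by
    rw [hR, LinearMap.comp_apply, LinearMap.comp_apply, LinearMap.comp_apply]
    have e1 : (complexBetti.map φ.hom (a₂ + a₁)).hom (complexBetti.map φ.inv (a₂ + a₁) y₀) = y₀ := by
      change complexBetti.map φ.hom _ (complexBetti.map φ.inv _ y₀) = y₀
      rw [← complexBetti.map_comp_apply', Iso.hom_inv_id, complexBetti.map_id]
      rfl
    rw [e1, hy₀, hW₂v x₀ z₀]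
    change W₁ (complexBetti.map (β_ C (X.pow e₂)).hom (a₂ + i) _) = _
    rw [map_braiding_hom_cross (rfl : a₂ + i = a₂ + i) (show i + a₂ = a₂ + i by omega) (T z₀) x₀, map_smul,
      hW₁v]
  refine Submodule.subset_span ⟨e₂ + e₁, a₂ + a₁, R, hRalg,
    ((-1 : ℂ) ^ (a₂ * i)) • complexBetti.map φ.inv (a₂ + a₁) y₀, ?_⟩
  rw [map_smul, hRy, smul_smul, ← pow_add, ← two_mul, pow_mul, neg_one_sq, one_pow, one_smul]

/-- **The powers of a dominated variety are dominated**: `Y` dominated by the powers of `X` ⟹ so is every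
`Y^{m+1} = Yᵐ ⊗ Y` (induction with `isDominatedByPowers_tensor`, starting from the point `Y⁰`).
[cite: Arapura2006, §1 Lemma 1.1 and §4 Lemma 4.2] -/
theorem isDominatedByPowers_pow_succ (hX : IsSmoothProjective dX X) {dY : ℕ} {Y : SchemeOver ℂ}
    (hY : IsSmoothProjective dY Y) (hdom : IsDominatedByPowers dY Y dX X) :
    ∀ m : ℕ, IsDominatedByPowers ((m + 1) * dY) (Y.pow (m + 1)) dX X
  | 0 => by
    have h := isDominatedByPowers_tensor hX (isSmoothProjective_unit_holds ℂ) hY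
      (isDominatedByPowers_unit hX) hdom
    rw [Nat.zero_add] at h
    rw [Nat.zero_add, Nat.one_mul]
    exact h
  | m + 1 => by
    have h := isDominatedByPowers_tensor hX (hY.pow (m + 1)) hY (isDominatedByPowers_pow_succ hX hY hdom m) hdom
    rw [show (m + 1 + 1) * dY = (m + 1) * dY + dY by ring]
    exact h

/-- **Arapura 2006, Lemma 4.2 (HC clause; motivation in the algebraic form of Lemma 1.1) — the Literature record
`HodgeTheory.Arapura2006_hodgeClasses_algebraic_of_isDominatedByPowers` DISCHARGED**: for `X`, `Y` smooth
projective over `ℂ` with `Y` dominated by the powers of `X`, the Hodge conjecture for all `X^{m+1}` implies the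
Hodge conjecture for `Y` (`hodgeConjectureFor_of_isDominatedByPowers`) and for every `Y^{m+1}` (the same theorem
for `Y^{m+1}`, dominated by `isDominatedByPowers_pow_succ`).  Users' `(h42 : Arapura2006_…)` are now fed this
theorem. [cite: Arapura2006, Lemma 4.2 and Lemma 1.1 (§4, §1)] [cite: Voisin2025, Cor. 2.12]
[cite: Fulton1998, §16.1 Prop. 16.1.1] -/
theorem Arapura2006_hodgeClasses_algebraic_of_isDominatedByPowers_holds :
    Arapura2006_hodgeClasses_algebraic_of_isDominatedByPowers :=
  fun _ _ _ _ hX hY hdom hpow ↦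
    ⟨hodgeConjectureFor_of_isDominatedByPowers hX hY hdom hpow, fun m ↦
      hodgeConjectureFor_of_isDominatedByPowers hX (hY.pow (m + 1))
        (isDominatedByPowers_pow_succ hX hY hdom m) hpow⟩

/-! ### The strict road of `CorCM/Stage4StrictAbelianType`, record-free -/

/-- **`HC_AV` ALONE ⟹ the Hodge conjecture for every smooth projective variety dominated by the powers of a
complex abelian variety, and for all its powers** — `hc_of_isDominatedByPowers_abelianVariety` with the Arapura
record discharged: no named fact remains. [cite: Arapura2006, Lemma 4.2 and Lemma 1.1] -/
theorem hc_of_isDominatedByPowers_abelianVariety_holds (hAV : HC_AV) (A : AbelianVariety ℂ) {dY : ℕ}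
    {Y : SchemeOver ℂ} (hY : IsSmoothProjective dY Y) (hdom : IsDominatedByPowers dY Y A.dim A.X) :
    HodgeConjectureFor dY Y ∧ ∀ m : ℕ, HodgeConjectureFor ((m + 1) * dY) (Y.pow (m + 1)) :=
  hc_of_isDominatedByPowers_abelianVariety Arapura2006_hodgeClasses_algebraic_of_isDominatedByPowers_holds
    hAV A hY hdom

/-- **`HC_K3Powers` ⟹ HC for the Hilbert schemes `S^{[n]}` of projective K3 surfaces and all their powers,
modulo the single GEOMETRIC record (de Cataldo–Migliorini 2002 Thm. 6.2.1)** — `hc_K3HilbertScheme_of_hc_K3Powers`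
with the Arapura record discharged. [cite: DecataldoMigliorini2002, Thm. 6.2.1] [cite: Arapura2006, Lemma 4.2 and Thm. 7.4] -/
theorem hc_K3HilbertScheme_of_hc_K3Powers_of_dCM
    (h74 : DecataldoMigliorini2002_hilbertScheme_isDominatedByPowers) (h : HC_K3Powers) {S H : SchemeOver ℂ}
    {n : ℕ} {Ξ : (S ⊗ H).left.IdealSheafData} (hS : Surfaces.IsK3Surface S) (hH : HilbertScheme.IsHilbertSchemeOfPoints n S H Ξ)
    (hHs : IsSmoothProjective (2 * n) H) :
    HodgeConjectureFor (2 * n) H ∧ ∀ m : ℕ, HodgeConjectureFor ((m + 1) * (2 * n)) (H.pow (m + 1)) :=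
  hc_K3HilbertScheme_of_hc_K3Powers Arapura2006_hodgeClasses_algebraic_of_isDominatedByPowers_holds h74 h hS
    hH hHs

end Products

end Summit.HodgeConjecture.CorCM.Stage4

end
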